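import Literature.Probability.LatticeModels.ClusterExpansionActivityPaths
import Literature.Probability.LatticeModels.PolymerGasRatio
import Literature.Probability.LatticeModels.PolymerPressureAnalytic
import HarnessLib

/-!
# `log Z` of an abstract polymer gas is Lipschitz in the activities (Kotecký–Preiss regime)

A small fourth layer on the tree's abstract Kotecký–Preiss cluster-expansion layer
(`PolymerGas`, `ClusterExpansion`, `ClusterExpansionActivityPaths`, `PolymerGasRatio`,
`PolymerPressureAnalytic`; polymers `P` with a reflexive symmetric incompatibility `inc`,
complex activities `w : P → ℂ`, the finite-volume partition function
`polymerPartitionFunction inc w Λ`, its Kotecký–Preiss logarithm `polymerLogZ inc w Λ`, the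
size function `a` and the finite-volume KP condition `IsKPVolume inc w a Λ`:
`∑_{γ' ∈ Λ, γ' ι γ} ‖w γ'‖ e^{a γ'} ≤ a γ` for `γ ∈ Λ`).

**What this file adds.** The COMPARISON of the partition functions of ONE polymer system under
TWO activity families `wA`, `wB` which both satisfy the KP condition with the same size function
on the same finite volume `Λ` — with no sign or positivity assumption on the activities:

* `isKPVolume_activitySegment`: the straight path `s ↦ wB + s (wA - wB)`, `s ∈ [0, 1]`, stays in
  the KP region (the KP condition is convex in the norms of the activities);
* `norm_polymerPartitionFunction_filter_not_inc_div_le_exp`: the one-polymer "marginal" ratio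
  `‖Z({γ' ∈ Λ : ¬ γ' ι δ}; w) / Z(Λ; w)‖ ≤ e^{a δ}` for `δ ∈ Λ` (the telescoped KP ratio bound of
  `ClusterExpansion` applied to the polymers incompatible with `δ`, whose total KP size is `≤ a δ`
  by the KP condition itself); hence the **logarithmic-derivative bound**
  `norm_sum_mul_polymerPartitionFunction_filter_div_le`:
  `‖(∑_{δ ∈ Λ} c δ · Z({¬ ι δ}; w)) / Z(Λ; w)‖ ≤ ∑_{δ ∈ Λ} ‖c δ‖ e^{a δ}` — by the chain rule along
  activity paths ([KP86, (13)], the tree's `hasDerivAt_polymerPartitionFunction_path`) the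
  left-hand side with `c = wA - wB` is `‖d/ds log Z(Λ; wB + s (wA - wB))‖`;
* `norm_polymerLogZ_sub_polymerLogZ_le` (**`log Z` is Lipschitz in the activities**):
  `‖log Z(Λ; wA) - log Z(Λ; wB)‖ ≤ ∑_{δ ∈ Λ} ‖wA δ - wB δ‖ e^{a δ}` for the Kotecký–Preiss
  branches (integrate the logarithmic derivative along the segment: the KP logarithm is a
  continuous logarithm of `Z` along it, `continuousOn_polymerLogZ_param`,
  `integral_div_eq_sub_of_exp_eq`);
* `abs_log_re_polymerPartitionFunction_sub_le`: the same for REAL (possibly SIGNED) activities,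
  with `Real.log` of the (positive) partition functions (`polymerLogZ_eq_log_of_real`);
* `norm_polymerLogZ_sub_le_of_split` (**hybrid split**; with budgets `ρ`, `W`:
  `norm_polymerLogZ_sub_le_of_budgets`, and `abs_log_re_sub_le_of_budgets` for real
  activities): for any set `O ⊆ Λ` of "old" polymers,
  `‖log Z(wA) - log Z(wB)‖ ≤ ∑_{δ ∈ Λ ∖ O} ‖wA δ - wB δ‖ e^{a δ} + ∑_{δ ∈ O} (‖wA δ‖ + ‖wB δ‖) e^{a δ}`
  — polymers outside `O` are matched ACTIVITY-WISE (a rate), polymers in `O` only need BOTH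
  activities small (a weight); `sum_kpTerm_add_kpTerm_le_of_pinned` bounds the `O`-part (both
  runs) by `2 ∑_{γ ∈ D} a γ` when every old polymer is incompatible with a polymer of a
  "pinned" set `D ⊆ Λ` (`sum_kpTerm_le_sum_of_incompatible`, once per activity family);
* `abs_log_mul_sub_log_mul_sub_le_of_budgets`: the form with normalising constants `cA, cB > 0`,
  `|log (cA Z(wA)) - log (cB Z(wB)) - (log cA - log cB)| ≤ (same bound)` — i.e. the two "runs"
  agree MODULO CONSTANTS up to the activity budget (the shape `|log Z' - log Z - c| ≤ vol·δ`).

Everything is PROVED from the tree's layer; no named fact, no new hypothesis shape beyond the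
definition `activitySegment`. The Kotecký–Preiss paper is cited for the device (formula (13) and
the zero-freeness / branch of `log 𝒵` of the Theorem p. 492), not for the statements, which are
folklore consequences (cf. Friedli–Velenik, Ch. 5, (5.29) for the one-polymer ratio bound).

**Use (context only, nothing of it is asserted here).** In a multi-step renormalisation scheme
whose successive effective densities are written, after exponentiation, as polymer gases with
SIGNED small activities (Bałaban's formats (1.90)/(1.98) of CMP 122 (1989) 355 and (2.12)–(2.13)
of CMP 116 (1988) 1, typed elsewhere in the tree as term FORMATS), two runs that share the recent
renormalisation steps are compared by `abs_log_re_sub_le_of_budgets`: recent-scale polymers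
activity-wise, old-scale polymers by the smallness of both activities. This replaces a
termwise "good/bad" matching of POSITIVE weights, which is unavailable for signed terms. Which
partition functions of such a scheme are polymer gases of this kind is not decided here.

Versions: v1 (2026-08-18): the 1 definition + 16 theorems below.  v1.1: module docstring only —
four declaration names in this header aligned with the file (cross-read D1); no declaration
changed.

## References

* [KP86] R. Kotecký, D. Preiss, *Cluster expansion for abstract polymer models*, Comm. Math.
  Phys. 103 (1986) 491–498: Theorem p. 492 (zero-freeness, the branch of `log 𝒵`), §3 formula
  (13) (derivative of `𝒵` along an activity path). [KoteckyPreiss1986]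
* S. Friedli, Y. Velenik, *Statistical Mechanics of Lattice Systems* (CUP 2017), Ch. 5,
  (5.29). [FriedliVelenik2017]
-/

noncomputable section

open Finset Set MeasureTheory intervalIntegral

namespace Literature.Probability.LatticeModels

variable {P : Type*} [DecidableEq P] {inc : P → P → Prop} [DecidableRel inc]

/-! ### The segment between two activity families -/

/-- The straight activity path from `wB` (at `s = 0`) to `wA` (at `s = 1`):
`activitySegment wA wB s = wB + s (wA - wB)`. [folklore] -/
def activitySegment (wA wB : P → ℂ) (s : ℝ) : P → ℂ := fun γ => wB γ + (s : ℂ) * (wA γ - wB γ)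

omit [DecidableEq P] in
/-- Unfolding the segment at a polymer. [folklore] -/
@[simp] theorem activitySegment_apply (wA wB : P → ℂ) (s : ℝ) (γ : P) :
    activitySegment wA wB s γ = wB γ + (s : ℂ) * (wA γ - wB γ) := rfl

omit [DecidableEq P] in
/-- At `s = 0` the segment is at `wB`. [folklore] -/
@[simp] theorem activitySegment_zero (wA wB : P → ℂ) : activitySegment wA wB 0 = wB := by
  funext γ; simp [activitySegment]

omit [DecidableEq P] in
/-- At `s = 1` the segment is at `wA`. [folklore] -/
@[simp] theorem activitySegment_one (wA wB : P → ℂ) : activitySegment wA wB 1 = wA := by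
  funext γ; simp [activitySegment]

omit [DecidableEq P] in
/-- On `[0, 1]` the segment is a convex combination: `‖wB γ + s (wA γ - wB γ)‖ ≤ (1 - s) ‖wB γ‖ + s ‖wA γ‖`.
[folklore] -/
theorem norm_activitySegment_le (wA wB : P → ℂ) {s : ℝ} (hs : s ∈ Set.Icc (0 : ℝ) 1) (γ : P) :
    ‖activitySegment wA wB s γ‖ ≤ (1 - s) * ‖wB γ‖ + s * ‖wA γ‖ := by
  have hdecomp : activitySegment wA wB s γ = ((1 - s : ℝ) : ℂ) * wB γ + (s : ℂ) * wA γ := by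
    simp only [activitySegment_apply, Complex.ofReal_sub, Complex.ofReal_one]
    ring
  rw [hdecomp]
  refine (norm_add_le _ _).trans (le_of_eq ?_)
  rw [norm_mul, norm_mul, Complex.norm_real, Complex.norm_real, Real.norm_eq_abs,
    Real.norm_eq_abs, abs_of_nonneg (by linarith [hs.2]), abs_of_nonneg hs.1]

omit [DecidableEq P] in
/-- Each coordinate of the segment is affine in `s`, with derivative `wA γ - wB γ`. [folklore] -/
theorem hasDerivAt_activitySegment (wA wB : P → ℂ) (γ : P) (s : ℝ) :
    HasDerivAt (fun s : ℝ => activitySegment wA wB s γ) (wA γ - wB γ) s := by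
  have h := (((hasDerivAt_id s).ofReal_comp).mul_const (wA γ - wB γ)).const_add (wB γ)
  simpa using h

omit [DecidableEq P] in
/-- Each coordinate of the segment is continuous in `s`. [folklore] -/
theorem continuous_activitySegment (wA wB : P → ℂ) (γ : P) :
    Continuous fun s : ℝ => activitySegment wA wB s γ :=
  continuous_iff_continuousAt.2 fun s => (hasDerivAt_activitySegment wA wB γ s).continuousAt

omit [DecidableEq P] in
/-- **The KP region is convex in the norms of the activities**: if `wA` and `wB` satisfy the
Kotecký–Preiss condition on `Λ` with the same size function `a`, so does every point
`wB + s (wA - wB)`, `s ∈ [0, 1]`, of the segment between them. [folklore] -/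
theorem isKPVolume_activitySegment {wA wB : P → ℂ} {a : P → ℝ} {Λ : Finset P}
    (hA : IsKPVolume inc wA a Λ) (hB : IsKPVolume inc wB a Λ) {s : ℝ} (hs : s ∈ Set.Icc (0 : ℝ) 1) :
    IsKPVolume inc (activitySegment wA wB s) a Λ := by
  intro γ hγ
  have hA' := hA γ hγ
  have hB' := hB γ hγ
  have h1s : 0 ≤ 1 - s := by linarith [hs.2]
  calc ∑ γ' ∈ Λ with inc γ' γ, kpTerm (activitySegment wA wB s) a γ'
      ≤ ∑ γ' ∈ Λ with inc γ' γ, ((1 - s) * kpTerm wB a γ' + s * kpTerm wA a γ') := by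
        refine Finset.sum_le_sum fun γ' _ => ?_
        unfold kpTerm
        have h := mul_le_mul_of_nonneg_right (norm_activitySegment_le wA wB hs γ') (Real.exp_nonneg (a γ'))
        linarith [h]
    _ = (1 - s) * ∑ γ' ∈ Λ with inc γ' γ, kpTerm wB a γ' + s * ∑ γ' ∈ Λ with inc γ' γ, kpTerm wA a γ' := by
        rw [Finset.sum_add_distrib, Finset.mul_sum, Finset.mul_sum]
    _ ≤ (1 - s) * a γ + s * a γ :=
        add_le_add (mul_le_mul_of_nonneg_left hB' h1s) (mul_le_mul_of_nonneg_left hA' hs.1)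
    _ = a γ := by ring

/-! ### The logarithmic-derivative bound -/

/-- **One-polymer marginal ratio.** In a KP volume `Λ`, for `δ ∈ Λ`,
`‖Z({γ' ∈ Λ : ¬ γ' ι δ}; w) / Z(Λ; w)‖ ≤ e^{a δ}`: the polymers removed are exactly those
incompatible with `δ`, whose total KP size `∑ ‖w γ'‖ e^{a γ'}` is `≤ a δ` by the KP condition, and
removing a set `D` costs a factor of norm `≤ exp (∑_{γ ∈ D} ‖w γ‖ e^{a γ})`
(`norm_polymerPartitionFunction_sdiff_div_le_of_kp`). [cite: KoteckyPreiss1986, Theorem p. 492 and §3 (13) (the coefficient 𝒵(B ∖ [γ']) of Φ(γ'))] -/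
theorem norm_polymerPartitionFunction_filter_not_inc_div_le_exp [Std.Refl inc] [Std.Symm inc]
    {w : P → ℂ} {a : P → ℝ} {Λ : Finset P} (hKP : IsKPVolume inc w a Λ) {δ : P} (hδ : δ ∈ Λ) :
    ‖polymerPartitionFunction inc w (Λ.filter fun γ' => ¬ inc γ' δ) /
        polymerPartitionFunction inc w Λ‖ ≤ Real.exp (a δ) := by
  rw [← sdiff_filter_inc_eq (inc := inc) Λ δ]
  refine (norm_polymerPartitionFunction_sdiff_div_le_of_kp hKP le_rfl (Finset.filter_subset _ _)).trans ?_
  exact Real.exp_le_exp.2 (hKP δ hδ)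

/-- **Logarithmic-derivative bound.** In a KP volume `Λ`, for any coefficients `c`,
`‖(∑_{δ ∈ Λ} c δ · Z({γ' ∈ Λ : ¬ γ' ι δ}; w)) / Z(Λ; w)‖ ≤ ∑_{δ ∈ Λ} ‖c δ‖ e^{a δ}`. With
`c = ẇ` the numerator is `d/ds Z(Λ; w_s)` ([KP86, (13)], `hasDerivAt_polymerPartitionFunction_path`),
so this bounds `‖d/ds log Z(Λ; w_s)‖`. [cite: KoteckyPreiss1986, §3 (13)] -/
theorem norm_sum_mul_polymerPartitionFunction_filter_div_le [Std.Refl inc] [Std.Symm inc]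
    {w : P → ℂ} {a : P → ℝ} {Λ : Finset P} (hKP : IsKPVolume inc w a Λ) (c : P → ℂ) :
    ‖(∑ δ ∈ Λ, c δ * polymerPartitionFunction inc w (Λ.filter fun γ' => ¬ inc γ' δ)) /
        polymerPartitionFunction inc w Λ‖ ≤ ∑ δ ∈ Λ, ‖c δ‖ * Real.exp (a δ) := by
  rw [Finset.sum_div]
  refine (norm_sum_le _ _).trans (Finset.sum_le_sum fun δ hδ => ?_)
  rw [mul_div_assoc, norm_mul]
  exact mul_le_mul_of_nonneg_left
    (norm_polymerPartitionFunction_filter_not_inc_div_le_exp hKP hδ) (norm_nonneg _)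

/-! ### `log Z` is Lipschitz in the activities -/

/-- **The Kotecký–Preiss logarithm is Lipschitz in the activities.** If `wA` and `wB` both
satisfy the KP condition on the finite volume `Λ` with the size function `a`, then
`‖log Z(Λ; wA) - log Z(Λ; wB)‖ ≤ ∑_{δ ∈ Λ} ‖wA δ - wB δ‖ e^{a δ}` for the Kotecký–Preiss branches
`polymerLogZ`. Proof: along the segment `w_s = wB + s (wA - wB)` (which stays KP) the KP
logarithm `s ↦ log Z(Λ; w_s)` is a continuous logarithm of the non-vanishing `C¹` function
`s ↦ Z(Λ; w_s)`, so `log Z(wA) - log Z(wB) = ∫₀¹ Ż_s/Z_s ds` (`integral_div_eq_sub_of_exp_eq`),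
and `‖Ż_s/Z_s‖ ≤ ∑_δ ‖wA δ - wB δ‖ e^{a δ}` by the logarithmic-derivative bound. No sign
assumption on the activities. [cite: KoteckyPreiss1986, Theorem p. 492 and §3 (13)] -/
theorem norm_polymerLogZ_sub_polymerLogZ_le [Std.Refl inc] [Std.Symm inc]
    {wA wB : P → ℂ} {a : P → ℝ} {Λ : Finset P}
    (hA : IsKPVolume inc wA a Λ) (hB : IsKPVolume inc wB a Λ) :
    ‖polymerLogZ inc wA Λ - polymerLogZ inc wB Λ‖ ≤ ∑ δ ∈ Λ, ‖wA δ - wB δ‖ * Real.exp (a δ) := by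
  classical
  -- the segment and the KP condition along it
  set w : ℝ → P → ℂ := activitySegment wA wB with hwdef
  have hKPs : ∀ s ∈ Set.Icc (0 : ℝ) 1, IsKPVolume inc (w s) a Λ := fun s hs =>
    isKPVolume_activitySegment hA hB hs
  -- `ζ = Z` along the segment, its derivative `ζ'` ([KP86, (13)])
  set ζ : ℝ → ℂ := fun s => polymerPartitionFunction inc (w s) Λ with hζdef
  set ζ' : ℝ → ℂ := fun s =>
    ∑ δ ∈ Λ, (wA δ - wB δ) * polymerPartitionFunction inc (w s) (Λ.filter fun γ' => ¬ inc γ' δ)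
    with hζ'def
  have hpath : ∀ (B : Finset P) (s : ℝ), HasDerivAt (fun s => polymerPartitionFunction inc (w s) B)
      (∑ δ ∈ B, (wA δ - wB δ) * polymerPartitionFunction inc (w s) (B.filter fun γ' => ¬ inc γ' δ)) s :=
    fun B s => hasDerivAt_polymerPartitionFunction_path B fun δ _ => hasDerivAt_activitySegment wA wB δ s
  have hderiv : ∀ s, HasDerivAt ζ (ζ' s) s := fun s => hpath Λ s
  have hcontZ : ∀ B : Finset P, Continuous fun s => polymerPartitionFunction inc (w s) B := fun B =>
    continuous_iff_continuousAt.2 fun s => (hpath B s).continuousAt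
  have hζ'c : Continuous ζ' :=
    continuous_finsetSum _ fun δ _ => continuous_const.mul (hcontZ _)
  have hne : ∀ s ∈ Set.Icc (0 : ℝ) 1, ζ s ≠ 0 := fun s hs =>
    polymerPartitionFunction_ne_zero_of_kp (hKPs s hs) le_rfl
  -- `ψ = log Z` along the segment is a continuous logarithm of `ζ` on `[0, 1]`
  set ψ : ℝ → ℂ := fun s => polymerLogZ inc (w s) Λ with hψdef
  have hrays : ∀ s ∈ Set.Icc (0 : ℝ) 1, ∀ u ∈ Set.Icc (0 : ℝ) 1,
      polymerPartitionFunction inc (fun γ => (u : ℂ) * w s γ) Λ ≠ 0 := fun s hs u hu =>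
    polymerPartitionFunction_ne_zero_of_kp ((hKPs s hs).ray hu) le_rfl
  have hψc : ContinuousOn ψ (Set.Icc 0 1) :=
    continuousOn_polymerLogZ_param (inc := inc) Λ
      (fun γ _ => (continuous_activitySegment wA wB γ).continuousOn) hrays
  have hexp : ∀ s ∈ Set.Icc (0 : ℝ) 1, Complex.exp (ψ s) = ζ s := fun s hs =>
    exp_polymerLogZ_of_kp (hKPs s hs) le_rfl
  have hint : ∫ t in (0 : ℝ)..1, ζ' t / ζ t = ψ 1 - ψ 0 :=
    integral_div_eq_sub_of_exp_eq zero_le_one hψc (fun t _ => hderiv t) hζ'c.continuousOn hne hexp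
  -- the integrand is bounded by the activity budget
  have hbound : ∀ t ∈ Set.uIoc (0 : ℝ) 1,
      ‖ζ' t / ζ t‖ ≤ ∑ δ ∈ Λ, ‖wA δ - wB δ‖ * Real.exp (a δ) := by
    intro t ht
    rw [Set.uIoc_of_le zero_le_one] at ht
    exact norm_sum_mul_polymerPartitionFunction_filter_div_le (hKPs t ⟨ht.1.le, ht.2⟩) _
  have hI := intervalIntegral.norm_integral_le_of_norm_le_const hbound
  rw [hint] at hI
  have h1 : ψ 1 = polymerLogZ inc wA Λ := by
    simp only [hψdef, hwdef, activitySegment_one]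
  have h0 : ψ 0 = polymerLogZ inc wB Λ := by
    simp only [hψdef, hwdef, activitySegment_zero]
  rw [h1, h0] at hI
  simpa using hI

/-- **Real (possibly signed) activities.** If `wA`, `wB` are REAL activities both satisfying the
KP condition on `Λ` with size function `a`, then `Z(Λ; wA)`, `Z(Λ; wB)` are positive reals and
`|log Z(Λ; wA) - log Z(Λ; wB)| ≤ ∑_{δ ∈ Λ} |wA δ - wB δ| e^{a δ}` with the real logarithm
(`polymerLogZ_eq_log_of_real`: in the KP region the KP branch of a real gas is `Real.log`). No
positivity of the activities is assumed. [cite: KoteckyPreiss1986, Theorem p. 492 and §3 (13)] -/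
theorem abs_log_re_polymerPartitionFunction_sub_le [Std.Refl inc] [Std.Symm inc]
    {wA wB : P → ℂ} {a : P → ℝ} {Λ : Finset P}
    (hA : IsKPVolume inc wA a Λ) (hB : IsKPVolume inc wB a Λ)
    (hAr : ∀ γ, (wA γ).im = 0) (hBr : ∀ γ, (wB γ).im = 0) :
    0 < (polymerPartitionFunction inc wA Λ).re ∧ 0 < (polymerPartitionFunction inc wB Λ).re ∧
      |Real.log (polymerPartitionFunction inc wA Λ).re - Real.log (polymerPartitionFunction inc wB Λ).re|
        ≤ ∑ δ ∈ Λ, ‖wA δ - wB δ‖ * Real.exp (a δ) := by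
  have hZA := polymerLogZ_eq_log_of_real (inc := inc) hAr (B := Λ) fun t ht =>
    polymerPartitionFunction_ne_zero_of_kp (hA.ray ht) le_rfl
  have hZB := polymerLogZ_eq_log_of_real (inc := inc) hBr (B := Λ) fun t ht =>
    polymerPartitionFunction_ne_zero_of_kp (hB.ray ht) le_rfl
  refine ⟨hZA.1, hZB.1, ?_⟩
  have h := norm_polymerLogZ_sub_polymerLogZ_le hA hB
  rw [hZA.2, hZB.2, ← Complex.ofReal_sub, Complex.norm_real, Real.norm_eq_abs] at h
  exact h

/-! ### The hybrid split: activity-wise matching off a set of old polymers -/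

/-- **Hybrid split.** For any set `O ⊆ Λ` ("old" polymers),
`‖log Z(Λ; wA) - log Z(Λ; wB)‖ ≤ ∑_{δ ∈ Λ ∖ O} ‖wA δ - wB δ‖ e^{a δ} + ∑_{δ ∈ O} (‖wA δ‖ e^{a δ} + ‖wB δ‖ e^{a δ})`:
outside `O` the two activity families are compared polymer by polymer, on `O` only the
smallness of BOTH is used (`‖wA δ - wB δ‖ ≤ ‖wA δ‖ + ‖wB δ‖`). [folklore] -/
theorem norm_polymerLogZ_sub_le_of_split [Std.Refl inc] [Std.Symm inc]
    {wA wB : P → ℂ} {a : P → ℝ} {Λ O : Finset P}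
    (hA : IsKPVolume inc wA a Λ) (hB : IsKPVolume inc wB a Λ) (hO : O ⊆ Λ) :
    ‖polymerLogZ inc wA Λ - polymerLogZ inc wB Λ‖ ≤
      (∑ δ ∈ Λ \ O, ‖wA δ - wB δ‖ * Real.exp (a δ)) + ∑ δ ∈ O, (kpTerm wA a δ + kpTerm wB a δ) := by
  refine (norm_polymerLogZ_sub_polymerLogZ_le hA hB).trans ?_
  rw [← Finset.sum_sdiff hO]
  refine add_le_add le_rfl (Finset.sum_le_sum fun δ _ => ?_)
  unfold kpTerm
  rw [← add_mul]
  exact mul_le_mul_of_nonneg_right (norm_sub_le _ _) (Real.exp_nonneg _)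

omit [DecidableEq P] in
/-- **Old polymers pinned at a set `D`.** If every polymer of `O ⊆ Λ` is incompatible with some
polymer of `D ⊆ Λ`, the KP condition bounds their total size: `∑_{δ ∈ O} ‖w δ‖ e^{a δ} ≤ ∑_{γ ∈ D} a γ`
(the tree's `sum_kpTerm_le_sum_of_incompatible`); so in the hybrid split the `O`-part is at most
`2 ∑_{γ ∈ D} a γ`. [folklore] -/
theorem sum_kpTerm_add_kpTerm_le_of_pinned {wA wB : P → ℂ} {a : P → ℝ} {Λ O D : Finset P}
    (hA : IsKPVolume inc wA a Λ) (hB : IsKPVolume inc wB a Λ) (hO : O ⊆ Λ) (hD : D ⊆ Λ)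
    (hpin : ∀ δ ∈ O, ∃ γ ∈ D, inc δ γ) :
    ∑ δ ∈ O, (kpTerm wA a δ + kpTerm wB a δ) ≤ 2 * ∑ γ ∈ D, a γ := by
  rw [Finset.sum_add_distrib, two_mul]
  exact add_le_add (sum_kpTerm_le_sum_of_incompatible hA hO hD hpin)
    (sum_kpTerm_le_sum_of_incompatible hB hO hD hpin)

/-- **Hybrid split with budgets.** If the activity-wise discrepancy outside `O` is at most `ρ`
and the total KP size of the old polymers under both families is at most `W`, then
`‖log Z(Λ; wA) - log Z(Λ; wB)‖ ≤ ρ + W`. [folklore] -/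
theorem norm_polymerLogZ_sub_le_of_budgets [Std.Refl inc] [Std.Symm inc]
    {wA wB : P → ℂ} {a : P → ℝ} {Λ O : Finset P} {ρ W : ℝ}
    (hA : IsKPVolume inc wA a Λ) (hB : IsKPVolume inc wB a Λ) (hO : O ⊆ Λ)
    (hrec : ∑ δ ∈ Λ \ O, ‖wA δ - wB δ‖ * Real.exp (a δ) ≤ ρ)
    (hold : ∑ δ ∈ O, (kpTerm wA a δ + kpTerm wB a δ) ≤ W) :
    ‖polymerLogZ inc wA Λ - polymerLogZ inc wB Λ‖ ≤ ρ + W :=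
  (norm_polymerLogZ_sub_le_of_split hA hB hO).trans (add_le_add hrec hold)

/-- **Hybrid split, real (possibly signed) activities.** With real activities,
`|log Z(Λ; wA) - log Z(Λ; wB)| ≤ ρ + W` for the real logarithms of the (positive) partition
functions, under the budgets of `norm_polymerLogZ_sub_le_of_budgets`. [folklore] -/
theorem abs_log_re_sub_le_of_budgets [Std.Refl inc] [Std.Symm inc]
    {wA wB : P → ℂ} {a : P → ℝ} {Λ O : Finset P} {ρ W : ℝ}
    (hA : IsKPVolume inc wA a Λ) (hB : IsKPVolume inc wB a Λ)
    (hAr : ∀ γ, (wA γ).im = 0) (hBr : ∀ γ, (wB γ).im = 0) (hO : O ⊆ Λ)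
    (hrec : ∑ δ ∈ Λ \ O, ‖wA δ - wB δ‖ * Real.exp (a δ) ≤ ρ)
    (hold : ∑ δ ∈ O, (kpTerm wA a δ + kpTerm wB a δ) ≤ W) :
    |Real.log (polymerPartitionFunction inc wA Λ).re - Real.log (polymerPartitionFunction inc wB Λ).re|
      ≤ ρ + W := by
  have hZA := polymerLogZ_eq_log_of_real (inc := inc) hAr (B := Λ) fun t ht =>
    polymerPartitionFunction_ne_zero_of_kp (hA.ray ht) le_rfl
  have hZB := polymerLogZ_eq_log_of_real (inc := inc) hBr (B := Λ) fun t ht =>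
    polymerPartitionFunction_ne_zero_of_kp (hB.ray ht) le_rfl
  have h := norm_polymerLogZ_sub_le_of_budgets hA hB hO hrec hold
  rw [hZA.2, hZB.2, ← Complex.ofReal_sub, Complex.norm_real, Real.norm_eq_abs] at h
  exact h

/-- **Matching modulo constants.** With real activities and normalising constants
`cA, cB > 0`, the normalised partition functions `cA Z(Λ; wA)`, `cB Z(Λ; wB)` satisfy
`|log (cA Z(wA)) - log (cB Z(wB)) - (log cA - log cB)| ≤ ρ + W` under the budgets of
`norm_polymerLogZ_sub_le_of_budgets`: the two logarithms agree modulo the constant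
`log cA - log cB` up to the activity budget (the shape `|log Z' - log Z - c| ≤ vol·δ` of a
matching-modulo-constants estimate). [folklore] -/
theorem abs_log_mul_sub_log_mul_sub_le_of_budgets [Std.Refl inc] [Std.Symm inc]
    {wA wB : P → ℂ} {a : P → ℝ} {Λ O : Finset P} {ρ W cA cB : ℝ}
    (hA : IsKPVolume inc wA a Λ) (hB : IsKPVolume inc wB a Λ)
    (hAr : ∀ γ, (wA γ).im = 0) (hBr : ∀ γ, (wB γ).im = 0) (hO : O ⊆ Λ)
    (hrec : ∑ δ ∈ Λ \ O, ‖wA δ - wB δ‖ * Real.exp (a δ) ≤ ρ)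
    (hold : ∑ δ ∈ O, (kpTerm wA a δ + kpTerm wB a δ) ≤ W) (hcA : 0 < cA) (hcB : 0 < cB) :
    |Real.log (cA * (polymerPartitionFunction inc wA Λ).re) -
        Real.log (cB * (polymerPartitionFunction inc wB Λ).re) - (Real.log cA - Real.log cB)|
      ≤ ρ + W := by
  obtain ⟨hZA, hZB, -⟩ := abs_log_re_polymerPartitionFunction_sub_le hA hB hAr hBr
  have h := abs_log_re_sub_le_of_budgets hA hB hAr hBr hO hrec hold
  rw [Real.log_mul hcA.ne' hZA.ne', Real.log_mul hcB.ne' hZB.ne']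
  have heq : Real.log cA + Real.log (polymerPartitionFunction inc wA Λ).re -
      (Real.log cB + Real.log (polymerPartitionFunction inc wB Λ).re) - (Real.log cA - Real.log cB) =
      Real.log (polymerPartitionFunction inc wA Λ).re - Real.log (polymerPartitionFunction inc wB Λ).re := by
    ring
  rw [heq]
  exact h

end Literature.Probability.LatticeModels
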